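import Mathlib
import HarnessLib
import Summits.ValiantsHypothesis.ValiantsHypothesis.Theses.MonotoneRestoration
import Literature.Computability.AlgebraicComplexity.ArithCircuit
import Literature.Computability.AlgebraicComplexity.ArithCircuitProofs
import Literature.Computability.AlgebraicComplexity.MonotoneStructure
import Literature.Computability.AlgebraicComplexity.PermanentIrreducible
import Literature.ModelTheory.FiniteModelTheory.CkEquiv
import Summits.ValiantsHypothesis.ValiantsHypothesis.Theorems.MonotoneRestorationMonotoneRestorationQPCosetCount
import Summits.ValiantsHypothesis.ValiantsHypothesis.Theorems.MonotoneRestorationMonotoneRestorationQPSymmetricLB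
import Summits.ValiantsHypothesis.ValiantsHypothesis.Theorems.MonotoneRestorationMonotoneRestorationQPSupportSymmetrisation
import Summits.ValiantsHypothesis.ValiantsHypothesis.Theorems.MonotoneRestorationMonotoneRestorationQPSparseRegime
import Summits.ValiantsHypothesis.ValiantsHypothesis.Theorems.MonotoneRestorationMonotoneRestorationQPBeta
import Literature.Computability.AlgebraicComplexity.SymmetricArithCircuit
import Literature.Computability.AlgebraicComplexity.DawarWilsenach2025Proofs
import Literature.GroupTheory.PermutationGroups.SmallIndexSubgroups
import Summits.ValiantsHypothesis.ValiantsHypothesis.Theorems.MonotoneRestorationQP.Negative.LoadBearing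
import Summits.ValiantsHypothesis.ValiantsHypothesis.Theorems.MonotoneRestorationMonotoneRestorationQPPermSupportCount

/-! TTRL-lite variant V19204 of stmt-ValiantsHypothesis-15886 -/

namespace Summit.ValiantsHypothesis.ValiantsHypothesis.Theorems

open Summit.ValiantsHypothesis.ValiantsHypothesis.Theses.MonotoneRestoration
open Literature.Computability.AlgebraicComplexity

/-- Coupling identity behind the row/column symmetry of the row-sum substitution, for an
arbitrary inner polynomial `p`: renaming rows by `σ` and columns by `τ` after substituting the
row sums `∑ j, X (i, j)` equals substituting the row sums into `rename σ p` (the column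
permutation `τ` is absorbed by reindexing each row sum). -/
theorem stub_esymmRowSums_structure_var19204 :
    ∀ (n : ℕ) (σ τ : Equiv.Perm (Fin n)) (p : MvPolynomial (Fin n) NNReal),
      MvPolynomial.rename (fun q : Fin n × Fin n => (σ q.1, τ q.2))
        (MvPolynomial.bind₁ (fun i : Fin n => ∑ j : Fin n, MvPolynomial.X (i, j)) p) =
      MvPolynomial.bind₁ (fun i : Fin n => ∑ j : Fin n, MvPolynomial.X (i, j))
        (MvPolynomial.rename σ p) := by
  intro n σ τ p
  have h :
      (fun i : Fin n =>
          MvPolynomial.rename (fun q : Fin n × Fin n => (σ q.1, τ q.2))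
            (∑ j : Fin n, (MvPolynomial.X (i, j) : MvPolynomial (Fin n × Fin n) NNReal))) =
        (fun i : Fin n =>
            ∑ j : Fin n, (MvPolynomial.X (i, j) : MvPolynomial (Fin n × Fin n) NNReal)) ∘ σ := by
    funext i
    simp only [Function.comp_apply, map_sum, MvPolynomial.rename_X]
    exact Equiv.sum_comp τ
      (fun j => (MvPolynomial.X (σ i, j) : MvPolynomial (Fin n × Fin n) NNReal))
  rw [MvPolynomial.rename_bind₁, MvPolynomial.bind₁_rename, h]

end Summit.ValiantsHypothesis.ValiantsHypothesis.Theorems
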